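/-
Copyright: the b2b-balaban cell (near-miss cell 7), T⁴-continuum fan-out; row NE7b ROUND-2 swarm, seat
t4-ne7b-formalise-leaf-04 (gen 9) — «SAT-LAWS» file B (journal INTENT l.18748; leaf-08 g11's first-refusal offer
F-leaf08g11-1 ∕ F2 (ii), l.17741 (3)): the SATURATED twins of this lineage's `HistoryZoneMassCluster` §4 (gen 3,
p217345) over file A `HistoryZoneMassLawFactor`.  Released under the licence of the surrounding project.
-/
import Summits.QuantumFields.BalabanUV.T4Continuum.Support.HistoryZoneMassLawFactor
import Summits.QuantumFields.BalabanUV.T4Continuum.Support.HistoryZoneMassCluster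

/-!
# Zone mass for PIECES under CLUSTER contact — the SATURATED law for the region reading

Summits-side support leaf of the T⁴-continuum cell (rung (B)+1 on a FINITE torus only; NOT infinite volume, NOT the
mass gap, NOT the Clay statement; NOT a proof of the spine estimate NE7b).  Row NE7b, route «COUNT», row S6g′
«MASS-BASED SIBLING COUNT» step (a), in the service of the smallness census (rows S12n∕S12o, finding F-leaf08g11-1
«the saturated collapse radius», ruling R-OWNER-23-15).  [folklore] bookkeeping on OUR carriers: the three §4 theorems
of `HistoryZoneMassCluster` (p217345) — `card_regZoneD_le_pieces`, `card_regZoneD_le_pieces_half`,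
`card_regZoneD_le_self` — re-run token for token over file A's SATURATED law for pieces
`HistoryZoneMassLawFactor.card_zone_le_pieces_sat` instead of p214316's `card_zone_le_pieces`: the level-pattern-free
factor `(2·cth c 1 s + 1)^d` (`cth c 1 s = s·(c+1)`) becomes leaf-08 g11's STRIDE-INDEPENDENT
`(2·csat c L + 1)^d` (`csat c L = 2(c+1) + 2(c+1)∕(L−1)`, `HistoryZoneEvolveSaturate` p229704), at the price `L ≥ 2`.
Nothing is quoted from print, nothing printed is asserted, no `[cite:]` tag, no `Prop`-valued fact minted (trigger
c1); constants SYMBOLIC in `(d, L, c, ρr, Cr, s, m)` (c2∕c6); no exit ∕ socket ∕ `HistoryConstants*` ∕ END file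
touched (c3); SIBLING module — no landed file is edited, nothing is re-plugged.

WHAT.  **`card_regZoneD_le_pieces_sat`**, **`card_regZoneD_le_pieces_half_sat`** (`m := s∕2`),
**`card_regZoneD_le_self_sat`** (the whole structure when it is a birth or a merger): binder lists = p217345's with
`hL : 2 ≤ L` and `cth c 1 s ↦ csat c L` in `hsmall` and in the conclusion, NOTHING else (`hrange hregL hCr hregN hconn
hs hm hsmall hθ0 hθ1 hθs (hG)` verbatim; `ρ = max ρr (2c+2)`, `C₁ = (2c+1)^d·Cr`); and
**`card_regZoneD_le_self_sat_of_record`**: at a stride `s ≥ 4` the saturated bound holds under p217345's OWN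
smallness (file A's `hsmall_sat_of_record`); §1b `sat_factor_le_closed` ∕ `cast_sat_base_le` (closed majorants of the
saturated factor for census letters).  `card_regZoneD_le_self` is the lemma by which the instance chain enters
the zone laws (`HistoryJoinsPlacedLaws.facts_zoneP_of_ne_renew`, leaf-05 g4, `Cr = 4·2^d`, `ρr = 1`); a `_sat`
re-plug of that chain (`HistoryJoinsPlacedLaws → …PlacedEnd∕…PlacedTwin → END`) would be one lemma name + the `hsmall`
letter per module and is NOT proposed here (census value already booked R-OWNER-23-15: `N = (2·csat 32 13 + 1)^4 = 143⁴`
instead of `(2·cth 32 1 34 + 1)^4 = 2245⁴`; leaf-08 g11's two engines, journal l.17741).  §2 sanity.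

HONEST: a law about OUR levelled reading; the headline's Prop (p224237) and every ∃-threshold of the END of record are
UNCHANGED by this file; Bałaban's regions ↦ the reading stays H3; nothing of H3 ∕ (B) ∕ BetaPertHyp or of the nine
discharged; NE7b NOT proved; spine 0∕9.  HONEST DEPENDENCY (cell): continuum YM on T⁴ ⇐ BetaPertH ∧ nine spine
estimates (0/9 proved); BetaPertH ⇐ (D1) ∧ (D4) ∧ CAP+tail; G-an2-4 gates asym, D1 and NE2/3/4.  This file changes
none of it.
-/

open Finset
open Literature.MathematicalPhysics.QuantumFieldTheory.Balaban1983to89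
open T4PersistenceDictionary T4PartnerMultiplicity
open Summit.QuantumFields.BalabanUV.T4Continuum
open PlacementSkeleton Crowding ZoneSkeleton ZoneTorus HistoryZones HistoryZoneMass HistoryZoneEvolve HistoryZoneMassLaw
open HistoryZoneEvolveLevels HistoryZoneMassLawLevels HistoryZoneMassRegions HistoryZoneMassPieces HistoryZoneMassPiecesLaw
open HistoryZoneEvolveSaturate HistoryZoneMassLawFactor HistoryZoneMassCluster

namespace Summit.QuantumFields.BalabanUV.T4Continuum.HistoryZoneMassClusterSat

noncomputable section

variable {d : ℕ} {ε : Type*} [DecidableEq ε] {sh : ε → PEv} {n L K c : ℕ} {lv : ℕ → ℕ} {G : Gen ε}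
  {reg : ε → Finset (Fin d → ℕ)}

/-! ## §1 The saturated law for the pieces of the region reading under cluster contact -/

/-- **THE SATURATED CARDINALITY LAW FOR THE REGION READING UNDER CLUSTER CONTACT** (no linked ∕ birth-cardinality ∕
binary-contact binder): for every PIECE `X` of `G` and every step `t ∈ [ftime X, K]`,
`#(regZoneD … t X) ≤ zmass sh θ (2A₁C₁) (4A) t X + 2A`, `A₁ = (2·csat c L + 1)^d`, `A = A₁·5^d`, `C₁ = (2c+1)^d·Cr`,
`ρ = max ρr (2c+2)`; `L ≥ 2`.  (= p217345's `card_regZoneD_le_pieces` with `cth c 1 s ↦ csat c L`.) [folklore] -/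
theorem card_regZoneD_le_pieces_sat (hL : 2 ≤ L) (hlv : LevelFn K lv) (hchr : Chrono (PEv.step ∘ sh) G)
    (hrange : ∀ b ∈ births G, InRange (n * L ^ (K - lv (sh b).step)) (reg b))
    {ρr : ℕ} (hregL : ∀ b ∈ births G, Linked (sideD n L K lv (sh b).step) ρr (reg b))
    {Cr : ℝ} (hCr : 0 ≤ Cr) (hregN : ∀ b ∈ births G, ((reg b).card : ℝ) ≤ Cr * (((sh b).fat : ℝ) + 1))
    (hconn : ∀ (t₀ : ℕ) (Y Z : Gen ε) (e : ε), Gen.merge Y Z e ∈ parts sh t₀ G →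
      TConn (fun a b => (regZoneD sh n L K lv c reg (sh e).step a ∩ regZoneD sh n L K lv c reg (sh e).step b).Nonempty)
        (parts sh (sh e).step (Gen.merge Y Z e)))
    {s m : ℕ} (hs : 1 ≤ s) (hm : ∀ u : ℕ, u + s ≤ K → lv u + m ≤ lv (u + s))
    (hsmall : (((2 * csat c L + 1) ^ d : ℕ) : ℝ) * (5 : ℝ) ^ d * ((max ρr (2 * c + 2) : ℕ) : ℝ) ≤ (L : ℝ) ^ m / 2)
    {θ : ℝ} (hθ0 : 0 ≤ θ) (hθ1 : θ ≤ 1) (hθs : 1 / 2 ≤ θ ^ s) :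
    ∀ (t tX : ℕ) (X : Gen ε), X ∈ parts sh tX G → ftime (PEv.step ∘ sh) X ≤ t → t ≤ K →
      ((regZoneD sh n L K lv c reg t X).card : ℝ) ≤
        zmass sh θ (2 * (((2 * csat c L + 1) ^ d : ℕ) : ℝ) * ((((2 * c + 1) ^ d : ℕ) : ℝ) * Cr))
            (4 * ((((2 * csat c L + 1) ^ d : ℕ) : ℝ) * (5 : ℝ) ^ d)) t X +
          2 * ((((2 * csat c L + 1) ^ d : ℕ) : ℝ) * (5 : ℝ) ^ d) :=
  have hL1 : 1 ≤ L := le_of_lt hL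
  card_zone_le_pieces_sat hL hlv (zoneStepsD_regZoneD hL1 hlv hchr hrange) hchr (ρ := max ρr (2 * c + 2))
    (le_max_of_le_right (by omega))
    (fun _ _ _ hX hft htK => linked_regZoneD_pieces hL1 hlv hchr hrange hregL hconn hX hft htK)
    (C₁ := (((2 * c + 1) ^ d : ℕ) : ℝ) * Cr) (by positivity)
    (fun b j hX => by
      have hb : b ∈ births G := births_subset_of_subE hX (by simp)
      have h1 : (regZoneD sh n L K lv c reg (sh b).step (Gen.born b j)).card ≤ (2 * c + 1) ^ d * (reg b).card := by
        rw [regZoneD_born_self]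
        exact card_thickT_le c (hrange b hb)
      have h2 := hregN b hb
      calc ((regZoneD sh n L K lv c reg (sh b).step (Gen.born b j)).card : ℝ)
          ≤ (((2 * c + 1) ^ d : ℕ) : ℝ) * ((reg b).card : ℝ) := by exact_mod_cast h1
        _ ≤ (((2 * c + 1) ^ d : ℕ) : ℝ) * (Cr * (((sh b).fat : ℝ) + 1)) :=
            mul_le_mul_of_nonneg_left h2 (Nat.cast_nonneg _)
        _ = (((2 * c + 1) ^ d : ℕ) : ℝ) * Cr * (((sh b).fat : ℝ) + 1) := by ring)
    hs hm hsmall hθ0 hθ1 hθs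

/-- **THE SAME WITH THE HALF-STRIDE ADVANCE** (`m := s∕2`). [folklore] -/
theorem card_regZoneD_le_pieces_half_sat (hL : 2 ≤ L) (hlv : LevelFn K lv) (hchr : Chrono (PEv.step ∘ sh) G)
    (hrange : ∀ b ∈ births G, InRange (n * L ^ (K - lv (sh b).step)) (reg b))
    {ρr : ℕ} (hregL : ∀ b ∈ births G, Linked (sideD n L K lv (sh b).step) ρr (reg b))
    {Cr : ℝ} (hCr : 0 ≤ Cr) (hregN : ∀ b ∈ births G, ((reg b).card : ℝ) ≤ Cr * (((sh b).fat : ℝ) + 1))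
    (hconn : ∀ (t₀ : ℕ) (Y Z : Gen ε) (e : ε), Gen.merge Y Z e ∈ parts sh t₀ G →
      TConn (fun a b => (regZoneD sh n L K lv c reg (sh e).step a ∩ regZoneD sh n L K lv c reg (sh e).step b).Nonempty)
        (parts sh (sh e).step (Gen.merge Y Z e)))
    {s : ℕ} (hs : 1 ≤ s)
    (hsmall : (((2 * csat c L + 1) ^ d : ℕ) : ℝ) * (5 : ℝ) ^ d * ((max ρr (2 * c + 2) : ℕ) : ℝ) ≤
      (L : ℝ) ^ (s / 2) / 2)
    {θ : ℝ} (hθ0 : 0 ≤ θ) (hθ1 : θ ≤ 1) (hθs : 1 / 2 ≤ θ ^ s) :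
    ∀ (t tX : ℕ) (X : Gen ε), X ∈ parts sh tX G → ftime (PEv.step ∘ sh) X ≤ t → t ≤ K →
      ((regZoneD sh n L K lv c reg t X).card : ℝ) ≤
        zmass sh θ (2 * (((2 * csat c L + 1) ^ d : ℕ) : ℝ) * ((((2 * c + 1) ^ d : ℕ) : ℝ) * Cr))
            (4 * ((((2 * csat c L + 1) ^ d : ℕ) : ℝ) * (5 : ℝ) ^ d)) t X +
          2 * ((((2 * csat c L + 1) ^ d : ℕ) : ℝ) * (5 : ℝ) ^ d) :=
  card_regZoneD_le_pieces_sat hL hlv hchr hrange hregL hCr hregN hconn hs (fun u _ => levelFn_add_half_le hlv u s)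
    hsmall hθ0 hθ1 hθs

/-- **THE SATURATED LAW FOR THE WHOLE STRUCTURE** (a birth or a merger) read by the region map under cluster contact
(= p217345's `card_regZoneD_le_self` with `cth c 1 s ↦ csat c L`; the instance chain's entry lemma). [folklore] -/
theorem card_regZoneD_le_self_sat (hL : 2 ≤ L) (hlv : LevelFn K lv) (hchr : Chrono (PEv.step ∘ sh) G)
    (hrange : ∀ b ∈ births G, InRange (n * L ^ (K - lv (sh b).step)) (reg b))
    {ρr : ℕ} (hregL : ∀ b ∈ births G, Linked (sideD n L K lv (sh b).step) ρr (reg b))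
    {Cr : ℝ} (hCr : 0 ≤ Cr) (hregN : ∀ b ∈ births G, ((reg b).card : ℝ) ≤ Cr * (((sh b).fat : ℝ) + 1))
    (hconn : ∀ (t₀ : ℕ) (Y Z : Gen ε) (e : ε), Gen.merge Y Z e ∈ parts sh t₀ G →
      TConn (fun a b => (regZoneD sh n L K lv c reg (sh e).step a ∩ regZoneD sh n L K lv c reg (sh e).step b).Nonempty)
        (parts sh (sh e).step (Gen.merge Y Z e)))
    {s m : ℕ} (hs : 1 ≤ s) (hm : ∀ u : ℕ, u + s ≤ K → lv u + m ≤ lv (u + s))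
    (hsmall : (((2 * csat c L + 1) ^ d : ℕ) : ℝ) * (5 : ℝ) ^ d * ((max ρr (2 * c + 2) : ℕ) : ℝ) ≤ (L : ℝ) ^ m / 2)
    {θ : ℝ} (hθ0 : 0 ≤ θ) (hθ1 : θ ≤ 1) (hθs : 1 / 2 ≤ θ ^ s)
    (hG : ∀ (Y : Gen ε) (e : ε) (h : ℕ), G ≠ Gen.renew Y e h) :
    ∀ t : ℕ, ftime (PEv.step ∘ sh) G ≤ t → t ≤ K →
      ((regZoneD sh n L K lv c reg t G).card : ℝ) ≤
        zmass sh θ (2 * (((2 * csat c L + 1) ^ d : ℕ) : ℝ) * ((((2 * c + 1) ^ d : ℕ) : ℝ) * Cr))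
            (4 * ((((2 * csat c L + 1) ^ d : ℕ) : ℝ) * (5 : ℝ) ^ d)) t G +
          2 * ((((2 * csat c L + 1) ^ d : ℕ) : ℝ) * (5 : ℝ) ^ d) := by
  intro t hft htK
  have hself : G ∈ parts sh (ftime (PEv.step ∘ sh) G + 1) G := by
    cases G with
    | born b j => exact self_mem_parts_born b j _
    | renew Y e h => exact absurd rfl (hG Y e h)
    | merge A B e => exact self_mem_parts_merge A B (Nat.lt_succ_self _)
  exact card_regZoneD_le_pieces_sat hL hlv hchr hrange hregL hCr hregN hconn hs hm hsmall hθ0 hθ1 hθs t _ G hself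
    hft htK

/-- **THE SATURATED LAW UNDER THE RECORD'S OWN SMALLNESS**: at a stride `s ≥ 4` (and `L ≥ 2`) p217345's hypothesis
`(2·cth c 1 s + 1)^d·5^d·ρ ≤ L^m∕2` already yields the saturated bound for the whole structure — a free improvement of
the constant for every consumer of `card_regZoneD_le_self`. [folklore] -/
theorem card_regZoneD_le_self_sat_of_record (hL : 2 ≤ L) (hlv : LevelFn K lv) (hchr : Chrono (PEv.step ∘ sh) G)
    (hrange : ∀ b ∈ births G, InRange (n * L ^ (K - lv (sh b).step)) (reg b))
    {ρr : ℕ} (hregL : ∀ b ∈ births G, Linked (sideD n L K lv (sh b).step) ρr (reg b))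
    {Cr : ℝ} (hCr : 0 ≤ Cr) (hregN : ∀ b ∈ births G, ((reg b).card : ℝ) ≤ Cr * (((sh b).fat : ℝ) + 1))
    (hconn : ∀ (t₀ : ℕ) (Y Z : Gen ε) (e : ε), Gen.merge Y Z e ∈ parts sh t₀ G →
      TConn (fun a b => (regZoneD sh n L K lv c reg (sh e).step a ∩ regZoneD sh n L K lv c reg (sh e).step b).Nonempty)
        (parts sh (sh e).step (Gen.merge Y Z e)))
    {s m : ℕ} (hs : 4 ≤ s) (hm : ∀ u : ℕ, u + s ≤ K → lv u + m ≤ lv (u + s))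
    (hsmall : (((2 * cth c 1 s + 1) ^ d : ℕ) : ℝ) * (5 : ℝ) ^ d * ((max ρr (2 * c + 2) : ℕ) : ℝ) ≤ (L : ℝ) ^ m / 2)
    {θ : ℝ} (hθ0 : 0 ≤ θ) (hθ1 : θ ≤ 1) (hθs : 1 / 2 ≤ θ ^ s)
    (hG : ∀ (Y : Gen ε) (e : ε) (h : ℕ), G ≠ Gen.renew Y e h) :
    ∀ t : ℕ, ftime (PEv.step ∘ sh) G ≤ t → t ≤ K →
      ((regZoneD sh n L K lv c reg t G).card : ℝ) ≤
        zmass sh θ (2 * (((2 * csat c L + 1) ^ d : ℕ) : ℝ) * ((((2 * c + 1) ^ d : ℕ) : ℝ) * Cr))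
            (4 * ((((2 * csat c L + 1) ^ d : ℕ) : ℝ) * (5 : ℝ) ^ d)) t G +
          2 * ((((2 * csat c L + 1) ^ d : ℕ) : ℝ) * (5 : ℝ) ^ d) :=
  card_regZoneD_le_self_sat hL hlv hchr hrange hregL hCr hregN hconn (le_trans (by norm_num) hs) hm
    (hsmall_sat_of_record hs hsmall) hθ0 hθ1 hθs hG

/-! ## §1b Sizes of the saturated factor (for census letters; symbolic) -/

/-- the saturated factor under a CLOSED stride- and `L`-free majorant: `(2·csat c L + 1)^d ≤ (8(c+1) + 1)^d`
(leaf-08 g11's `csat_le_four_mul`: `csat c L ≤ 4(c+1)`). [folklore] -/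
theorem sat_factor_le_closed (c L d : ℕ) : (2 * csat c L + 1) ^ d ≤ (8 * (c + 1) + 1) ^ d :=
  Nat.pow_le_pow_left (by have := csat_le_four_mul c L; omega) d

/-- … and the `L`-dependent real form of its base: `2·csat c L + 1 ≤ 4(c+1)·L∕(L−1) + 1` (`L ≥ 2`; leaf-08 g11's
`cast_csat_le`). [folklore] -/
theorem cast_sat_base_le {L : ℕ} (hL : 2 ≤ L) (c : ℕ) :
    ((2 * csat c L + 1 : ℕ) : ℝ) ≤ 4 * ((c : ℝ) + 1) * (L : ℝ) / ((L : ℝ) - 1) + 1 := by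
  have h := cast_csat_le hL c
  have hL1 : (0 : ℝ) < (L : ℝ) - 1 := by
    have : (2 : ℝ) ≤ (L : ℝ) := by exact_mod_cast hL
    linarith
  push_cast
  have e : 4 * ((c : ℝ) + 1) * (L : ℝ) / ((L : ℝ) - 1) = 2 * (2 * ((c : ℝ) + 1) * (L : ℝ) / ((L : ℝ) - 1)) := by ring
  rw [e]
  linarith

/-! ## §2 Sanity (decided; the only numerals of this file) -/

namespace Sanity

/-- the factor of this file against p217345's at the cell's letters `(c, L, s) = (32, 13, 34)`, `d = 4`: `143⁴ = 418161601`
against `2245⁴ = 25401852000625` (decided on the closed naturals) -/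
example : (2 * csat 32 13 + 1) ^ 4 = 418161601 ∧ (2 * cth 32 1 34 + 1) ^ 4 = 25401852000625 := by decide

/-- the `s ≥ 4` clause of `card_regZoneD_le_self_sat_of_record` is where the saturated radius drops below the
level-pattern-free one: `csat 32 13 = 71 ≤ cth 32 1 4 = 132` but `cth 32 1 2 = 66 < 71` (decided) -/
example : csat 32 13 ≤ cth 32 1 4 ∧ cth 32 1 2 < csat 32 13 := by decide

end Sanity

end

end Summit.QuantumFields.BalabanUV.T4Continuum.HistoryZoneMassClusterSat
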